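import Mathlib

/-!
# `OnePercentCertificate` (stmt-AtomisticToContinuum-11958) — line `SketchIdeator5`: the booking sum

Line `SketchIdeator5` (skeleton `Cruxes/OnePercentCertificate/Lines/SketchIdeator5.lean`, lead
prover-line-stmt-AtomisticToContinuum-11958-a2-0).  The generic finite-sum glue of the line (Lagarias's
local-density theorem in ENERGY form, with zero-sum corrections and averaging windows): on a finite index
type of sites, let `A` be booked pair energy (total `E`), `B` booked content (total `≤ n`), `φ` an
antisymmetric correction flow and `M` window weights with unit column sums.  If every windowed corrected
star `∑_b M a b · (A b + κ B b + ∑_c φ b c)` is `≥ 0` and `κ ≥ 0`, then `−κ·n ≤ E`.  Pure algebra over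
`Finset` sums; no project imports, no definitions. [folklore]
-/

noncomputable section

open scoped BigOperators

namespace Summit.AtomisticToContinuum.Crystallization.Theorems.FiveRingBooking

/-- An antisymmetric function on a finite type has zero double sum: the double sum equals its own negative
after swapping the summation order. [folklore] -/
theorem sum_sum_eq_zero_of_antisymm {ι : Type} [Fintype ι] (φ : ι → ι → ℝ)
    (hφ : ∀ a b, φ a b = -φ b a) : ∑ b, ∑ c, φ b c = 0 := by
  have h : ∑ b, ∑ c, φ b c = -∑ b, ∑ c, φ b c :=
    calc ∑ b, ∑ c, φ b c = ∑ b, ∑ c, -φ c b :=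
          Finset.sum_congr rfl fun b _ => Finset.sum_congr rfl fun c _ => hφ b c
      _ = -∑ b, ∑ c, φ c b := by simp only [Finset.sum_neg_distrib]
      _ = -∑ b, ∑ c, φ b c := by rw [Finset.sum_comm]
  linarith

/-- Summing windowed quantities over all windows removes the windows when the weights have unit column
sums: `∑_a ∑_b M a b · X b = ∑_b X b`. [folklore] -/
theorem sum_sum_window_mul_eq {ι : Type} [Fintype ι] (M : ι → ι → ℝ) (X : ι → ℝ)
    (hM1 : ∀ b, ∑ a, M a b = 1) : ∑ a, ∑ b, M a b * X b = ∑ b, X b := by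
  rw [Finset.sum_comm]
  refine Finset.sum_congr rfl fun b _ => ?_
  rw [← Finset.sum_mul, hM1 b, one_mul]

/-- **Booking sum** (Lagarias's local-density theorem, energy form, with flows and windows).  On a finite
index type of sites, let `A` (booked energy, total `E`), `B` (booked content, total `≤ n`), an antisymmetric
flow `φ` and nonnegative window weights `M` with unit column sums be given.  If every windowed corrected star
`∑_b M a b · (A b + κ B b + ∑_c φ b c)` is `≥ 0` and `κ ≥ 0`, then `−κ·n ≤ E`: summing over `a` removes the
windows (column sums `1`), the flow cancels by antisymmetry, and `κ ∑ B ≤ κ n`.  (Nonnegativity of `M` is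
not used.)  Lagarias 2002, Thm 2.1 in energy form with zero-sum corrections. [folklore] -/
theorem stub_bookingSum :
    ∀ {ι : Type} [Fintype ι] (E κ n : ℝ) (A B : ι → ℝ) (φ M : ι → ι → ℝ), 0 ≤ κ →
      (∀ a b, φ a b = -φ b a) → ∑ a, A a = E → ∑ a, B a ≤ n →
      (∀ a b, 0 ≤ M a b) → (∀ b, ∑ a, M a b = 1) →
      (∀ a, 0 ≤ ∑ b, M a b * (A b + κ * B b + ∑ c, φ b c)) → -(κ * n) ≤ E := by
  intro ι _ E κ n A B φ M hκ hφ hA hB _ hM1 hpos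
  -- sum the windowed stars over `a`: the windows disappear
  have h0 : 0 ≤ ∑ b, (A b + κ * B b + ∑ c, φ b c) := by
    rw [← sum_sum_window_mul_eq M (fun b => A b + κ * B b + ∑ c, φ b c) hM1]
    exact Finset.sum_nonneg fun a _ => hpos a
  -- split the sum: energy `E`, content `κ ∑ B`, flow `0`
  rw [Finset.sum_add_distrib, Finset.sum_add_distrib, sum_sum_eq_zero_of_antisymm φ hφ, hA,
    ← Finset.mul_sum] at h0
  have hκB : κ * ∑ b, B b ≤ κ * n := mul_le_mul_of_nonneg_left hB hκ
  linarith

end Summit.AtomisticToContinuum.Crystallization.Theorems.FiveRingBooking
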